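import Mathlib
import Summits.ValiantsHypothesis.ValiantsHypothesis.Theorems.NewtonUnitEquationsDissociatedUniformTotalsLaw
import Summits.ValiantsHypothesis.ValiantsHypothesis.Theorems.NewtonUnitEquationsDissociatedUniformTotalsLawUnion
import Summits.ValiantsHypothesis.ValiantsHypothesis.Theorems.NewtonUnitEquationsDissociatedUniformTotalsLawIntervalUnion
import Summits.ValiantsHypothesis.ValiantsHypothesis.Theorems.NewtonUnitEquationsDissociatedUniformTotalsLawIntervalUnionLog
import Summits.ValiantsHypothesis.ValiantsHypothesis.Theorems.NewtonUnitEquationsDissociatedUniformTotalsLawIntervalUnionFatWindows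
import HarnessLib

/-!
# Crux `NewtonUnitEquations.DissociatedUniform` (stmt-ValiantsHypothesis-5905), `n = 3` totals law of model (Q**):
# BANDS — preimages of cyclic windows under homomorphisms `G →+ ℤ/q`, arbitrary finite abelian group, arbitrary pairs

`…TotalsLawIntervalUnionLinear` proved `IntervalUnionVertBound 24` (windows of `ℤ/q`) and `…IntervalUnionArc` its cyclic-arc form in
any finite abelian group.  Here the complementary general-`G` stratum: BANDS `Z = φ⁻¹[t, t+m)` for a homomorphism `φ : G →+ ℤ/q`
(e.g. `[t, t+m) × H` in `ℤ/q × H`; level sets of a third curve depending on a `ℤ/q`-valued coordinate through an interval-valued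
function).  For ALL `a b : G → ℝ²`:
* `unionVert_band_le : unionVert a b (φ⁻¹' cycInterval q t m) s ≤ 32·|G|` (pointwise, every class); `unionTotal_band_le` (`≤ 32|G|²`);
* `classVert_le_of_band_levels` / `totalVert_le_of_band_levels`: third curves with `≤ k` values on band level sets: `V_s ≤ 32k|G|`
  POINTWISE and `T(a,b,c) ≤ 32k|G|²`, arbitrary pair.
Mechanism: `U_s(Z) = ⋃_x (a x + ⋃_{n ∈ [σ_x, σ_x + m)} b(φ⁻¹ n))` (`unionPts_band_eq`, `σ_x = winStart t m (φ s) (φ x)`) is a union of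
`|G|` translated windows of one length of the FAT fibre sequence `n ↦ b(φ⁻¹(n mod q))` (`bandFib`), so
`…IntervalUnionFatWindows.ncard_extremePoints_fatWindows_le` gives `8|G| + 8·(three periods) = 32|G|`.
Honest label: a stratum theorem; `UnionTotalsLaw C` and `TotalsLawThree C` remain OPEN and are asserted nowhere; nothing here bears on
VP ≠ VNP. [folklore]
-/

set_option linter.dupNamespace false -- `ValiantsHypothesis.ValiantsHypothesis` (summit = problem) in every name

open Finset
open scoped Pointwise

namespace Summit.ValiantsHypothesis.ValiantsHypothesis.Theorems.NewtonUnitEquationsDissociatedUniform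

namespace TotalsLaw

open Literature.Computability.AlgebraicComplexity.KPTT.PlanarMinkowski

/-! ### BANDS: preimages of cyclic windows under homomorphisms to `ℤ/q`, arbitrary finite abelian group -/

section Bands

variable {G : Type*} [AddCommGroup G] [Fintype G] {q : ℕ}

/-- The labels of `G` over the residue `n` of `ℤ/q` under `φ`. -/
noncomputable def bandFib (φ : G →+ ZMod q) (n : ℕ) : Finset G := Finset.univ.filter fun y => φ y = (n : ZMod q)

/-- `bandFib` is `q`-periodic. [folklore] -/
theorem bandFib_add (φ : G →+ ZMod q) (n : ℕ) : bandFib φ (n + q) = bandFib φ n := by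
  unfold bandFib; congr 1; ext y; push_cast; rw [ZMod.natCast_self, add_zero]

/-- One period of `bandFib` partitions `G`: `Σ_{n<q} #bandFib n = |G|`. [folklore] -/
theorem sum_card_bandFib [NeZero q] (φ : G →+ ZMod q) : ∑ n ∈ Finset.range q, (bandFib φ n).card = Fintype.card G := by
  rw [← Finset.card_univ, Finset.card_eq_sum_card_fiberwise (s := Finset.univ) (t := Finset.range q)
    (f := fun y : G => (φ y).val) (fun y _ => Finset.mem_coe.2 (Finset.mem_range.2 (ZMod.val_lt _)))]
  refine Finset.sum_congr rfl fun n hn => ?_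
  unfold bandFib
  congr 1; ext y
  simp only [Finset.mem_filter, Finset.mem_univ, true_and]
  constructor
  · intro h; rw [h, ZMod.val_natCast, Nat.mod_eq_of_lt (Finset.mem_range.1 hn)]
  · intro h; rw [← h, ZMod.natCast_zmod_val]

/-- Sums over several periods of a periodic sequence. [folklore] -/
private theorem sum_range_mul_periodic (g : ℕ → ℕ) (hq : ∀ n, g (n + q) = g n) : ∀ k : ℕ,
    ∑ n ∈ Finset.range (k * q), g n = k * ∑ n ∈ Finset.range q, g n := by
  have hshift : ∀ k n : ℕ, g (k * q + n) = g n := by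
    intro k
    induction k with
    | zero => intro n; rw [zero_mul, zero_add]
    | succ k ih => intro n; rw [add_mul, one_mul, show k * q + q + n = (k * q + n) + q by ring, hq, ih]
  intro k
  induction k with
  | zero => simp
  | succ k ih =>
    rw [add_mul, one_mul, Finset.sum_range_add, ih, add_mul, one_mul]
    congr 1
    exact Finset.sum_congr rfl fun n _ => hshift k n

/-- **The fibre union over a BAND is a union of translated windows of one length of the fat fibre sequence.** [folklore] -/
theorem unionPts_band_eq [NeZero q] (φ : G →+ ZMod q) (a b : G → (Fin 2 → ℝ)) (t m : ℕ) (s : G) :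
    unionPts a b (φ ⁻¹' (cycInterval q t m : Set (ZMod q))) s =
      ⋃ x : G, (a x +ᵥ ⋃ n ∈ Set.Ico (winStart t m (φ s) (φ x)) (winStart t m (φ s) (φ x) + m),
        (b '' (bandFib φ n : Set G))) := by
  ext p
  rw [mem_unionPts]; simp only [Set.mem_iUnion]
  constructor
  · rintro ⟨x, y, hZ, rfl⟩
    rw [Set.mem_preimage, Finset.mem_coe, cycInterval, Finset.mem_image] at hZ
    obtain ⟨i, hi, hiy⟩ := hZ; rw [Finset.mem_range] at hi
    refine ⟨x, ?_⟩
    rw [Set.mem_vadd_set]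
    refine ⟨b y, ?_, vadd_eq_add _ _⟩
    rw [Set.mem_iUnion₂]
    refine ⟨winStart t m (φ s) (φ x) + (m - 1 - i), ⟨Nat.le_add_right _ _, by omega⟩, ⟨y, ?_, rfl⟩⟩
    rw [Finset.mem_coe, bandFib, Finset.mem_filter]
    refine ⟨Finset.mem_univ _, ?_⟩
    -- the residue of `y` is `σ + (m - 1 - i)`
    have hy : φ y = φ s - φ x - ((t + i : ℕ) : ZMod q) := by
      rw [map_sub, map_sub] at hiy; rw [hiy]; abel
    rw [hy]
    conv_rhs => rw [Nat.cast_add, winStart, ZMod.natCast_zmod_val, Nat.cast_sub (by omega : i ≤ m - 1)]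
    push_cast
    ring
  · rintro ⟨x, hp⟩
    rw [Set.mem_vadd_set] at hp
    obtain ⟨z, hz, rfl⟩ := hp
    rw [Set.mem_iUnion₂] at hz
    obtain ⟨n, ⟨hn1, hn2⟩, hz⟩ := hz
    obtain ⟨y, hy, rfl⟩ := hz
    rw [Finset.mem_coe, bandFib, Finset.mem_filter] at hy
    refine ⟨x, y, ?_, vadd_eq_add _ _⟩
    rw [Set.mem_preimage, Finset.mem_coe, cycInterval, Finset.mem_image]
    set σ := winStart t m (φ s) (φ x) with hσdef
    refine ⟨m - 1 - (n - σ), Finset.mem_range.2 (by omega), ?_⟩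
    have hσ : ((σ : ℕ) : ZMod q) = φ s - φ x - (t : ZMod q) - ((m - 1 : ℕ) : ZMod q) := by
      rw [hσdef]; unfold winStart; exact ZMod.natCast_zmod_val _
    have hn_eq : ((n : ℕ) : ZMod q) = ((σ : ℕ) : ZMod q) + ((n - σ : ℕ) : ZMod q) := by
      rw [← Nat.cast_add]; congr 1; omega
    have hi : ((m - 1 - (n - σ) : ℕ) : ZMod q) = ((m - 1 : ℕ) : ZMod q) - ((n - σ : ℕ) : ZMod q) :=
      Nat.cast_sub (by omega)
    rw [map_sub, map_sub, hy.2, Nat.cast_add, hi, hn_eq, hσ]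
    ring

/-- **THE BAND UNION BOUND in an arbitrary finite abelian group:** for every homomorphism `φ : G →+ ℤ/q`, every cyclic window
`[t, t+m)` of `ℤ/q` and all `a b : G → ℝ²`, the band `Z = φ⁻¹[t, t+m)` has `#vert conv U_s(Z) ≤ 32·|G|` for every class `s`. -/
theorem unionVert_band_le [NeZero q] [DecidableEq G] (φ : G →+ ZMod q) (a b : G → (Fin 2 → ℝ)) (t m : ℕ) (s : G) :
    unionVert a b (φ ⁻¹' (cycInterval q t m : Set (ZMod q))) s ≤ 32 * Fintype.card G := by
  classical
  -- reduce to windows of length `≤ q`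
  wlog hm : m ≤ q generalizing m
  · have h := this q le_rfl
    rwa [cycInterval_eq_univ_of_le t le_rfl, ← cycInterval_eq_univ_of_le t (le_of_not_ge hm)] at h
  have hq : 0 < q := Nat.pos_of_ne_zero (NeZero.ne q)
  unfold unionVert; rw [unionPts_band_eq]
  have hmain := ncard_extremePoints_fatWindows_le b (bandFib φ) a (fun x => winStart t m (φ s) (φ x)) m q
    (fun x => winStart_lt t m (φ s) (φ x))
  -- the fat column count over `(q/m + 2)m ≤ 3q` labels is at most three periods
  have hper := sum_range_mul_periodic (fun n => (bandFib φ n).card) (fun n => by show (bandFib φ (n + q)).card = (bandFib φ n).card; rw [bandFib_add]) 3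
  rw [sum_card_bandFib] at hper
  have hle : ∑ n ∈ Finset.range ((q / m + 2) * m), (bandFib φ n).card ≤ 3 * Fintype.card G := by
    rw [← hper]
    have h1 : m * (q / m) ≤ q := Nat.mul_div_le q m
    have h2 : (q / m + 2) * m = m * (q / m) + 2 * m := by ring
    exact Finset.sum_le_sum_of_subset (Finset.range_mono (by omega))
  omega

/-- … and in total over the classes: `≤ 32·|G|²`. -/
theorem unionTotal_band_le [NeZero q] [DecidableEq G] (φ : G →+ ZMod q) (a b : G → (Fin 2 → ℝ)) (t m : ℕ) :
    unionTotal a b (φ ⁻¹' (cycInterval q t m : Set (ZMod q))) ≤ 32 * Fintype.card G ^ 2 := by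
  unfold unionTotal
  calc ∑ s, unionVert a b (φ ⁻¹' (cycInterval q t m : Set (ZMod q))) s ≤ ∑ _s : G, 32 * Fintype.card G :=
        Finset.sum_le_sum fun s _ => unionVert_band_le φ a b t m s
    _ = 32 * Fintype.card G ^ 2 := by rw [Finset.sum_const, Finset.card_univ, smul_eq_mul]; ring

/-- **The `n = 3` law on the BAND-VALUED third-curve stratum, POINTWISE:** if the third curve factors as `c = g ∘ φ` through a
homomorphism `φ : G →+ ℤ/q` with `g` constant on `≤ k` cyclic intervals covering its range (every level set of `c` a band), then
`V_s ≤ 32·k·|G|` for every class — `a, b` ARBITRARY. -/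
theorem classVert_le_of_band_levels [NeZero q] [DecidableEq G] (φ : G →+ ZMod q) (a b c : G → (Fin 2 → ℝ)) [DecidableEq (Fin 2 → ℝ)]
    (hc : ∀ v, ∃ t m : ℕ, c ⁻¹' {v} = φ ⁻¹' (cycInterval q t m : Set (ZMod q))) {k : ℕ}
    (hk : (Finset.univ.image c).card ≤ k) (s : G) :
    classVert a b c s ≤ 32 * k * Fintype.card G := by
  calc classVert a b c s ≤ ∑ v ∈ Finset.univ.image c, unionVert a b (c ⁻¹' {v}) s := classVert_le_sum_unionVert a b c s
    _ ≤ ∑ _v ∈ Finset.univ.image c, 32 * Fintype.card G :=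
        Finset.sum_le_sum fun v _ => by
          obtain ⟨t, m, h⟩ := hc v
          rw [h]
          exact unionVert_band_le φ a b t m s
    _ ≤ 32 * k * Fintype.card G := by
        rw [Finset.sum_const, smul_eq_mul]
        calc (Finset.univ.image c).card * (32 * Fintype.card G) ≤ k * (32 * Fintype.card G) :=
            Nat.mul_le_mul_right _ hk
          _ = 32 * k * Fintype.card G := by ring

/-- **… and in TOTAL:** `T(a,b,c) ≤ 32·k·|G|²` on the band-valued third-curve stratum with `≤ k` values, `a, b` arbitrary. -/
theorem totalVert_le_of_band_levels [NeZero q] [DecidableEq G] (φ : G →+ ZMod q) (a b c : G → (Fin 2 → ℝ)) [DecidableEq (Fin 2 → ℝ)]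
    (hc : ∀ v, ∃ t m : ℕ, c ⁻¹' {v} = φ ⁻¹' (cycInterval q t m : Set (ZMod q))) {k : ℕ}
    (hk : (Finset.univ.image c).card ≤ k) :
    totalVert a b c ≤ 32 * k * Fintype.card G ^ 2 := by
  unfold totalVert
  calc ∑ s, classVert a b c s ≤ ∑ _s : G, 32 * k * Fintype.card G :=
        Finset.sum_le_sum fun s _ => classVert_le_of_band_levels φ a b c hc hk s
    _ = 32 * k * Fintype.card G ^ 2 := by rw [Finset.sum_const, Finset.card_univ, smul_eq_mul]; ring

end Bands

end TotalsLaw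

end Summit.ValiantsHypothesis.ValiantsHypothesis.Theorems.NewtonUnitEquationsDissociatedUniform
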